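import Literature.AlgebraicGeometry.Modules.MatrixCocycleGluing
import HarnessLib

/-!
# The local frames of the module glued from a cocycle of invertible matrices

Continuation of `Modules/MatrixCocycleGluing.lean`: for a cocycle of invertible matrices
`c = (U_a, I_a, g_{ab})` on a scheme `X` (`MatrixCocycle`) and the glued `𝒪_X`-module `glued c`,
the column sections `t_{b,k}` over `U_b` assemble to a **local frame**
`frame c b : 𝒪^{I_b} ≅ (glued c)|_{U_b}` (`basisSection_frame`: its basis sections are the
`t_{b,k}`), the **transition matrices of these frames are the `g_{ab}`** (`transition_frame`), and
`glued c` is finite locally free as soon as the `U_a` cover `X` (`isFiniteLocallyFree_glued`)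
(Hartshorne II Ex. 5.18: a locally free sheaf with prescribed transition matrices). The frame is
built from the coordinate morphisms `s ↦ (s_b)_k` (`coordHom`) and the coprojections of the free
module; maps out of the copies of `𝒪` are compared through Mathlib's `unitHomEquiv`.
Everything is proved; no named facts.

## References

* R. Hartshorne, *Algebraic Geometry*, GTM 52 (1977), II Ex. 5.18. [Hartshorne1977]
* The Stacks Project, Tag 01C6 (finite locally free modules). [StacksProject]
-/

noncomputable section

open CategoryTheory AlgebraicGeometry Opposite TopologicalSpace Limits

namespace Literature.AlgebraicGeometry.Modules

open Literature.AlgebraicGeometry.Motives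

universe u

variable {X : Scheme.{u}} {ι : Type u}

namespace MatrixCocycle

variable (c : MatrixCocycle X ι)

/-- The `k`-th coordinate `s ↦ (s_b)_k` as a morphism `(glued c)|_{U_b} → 𝒪|_{U_b}`. [folklore] -/
def coordHom (b : ι) (k : c.I b) : c.glued.over (c.U b) ⟶ (unitModule X).over (c.U b) where
  val := PresheafOfModules.homMk
    { app := fun V => AddCommGrpCat.ofHom
        { toFun := fun s =>
            (secRes X (le_inf le_rfl V.unop.hom.le) (c.comp s b k) : Γ(X, V.unop.left))
          map_zero' := by
            change secRes X _ (c.comp (0 : Γ(c.glued, V.unop.left)) b k) = 0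
            exact map_zero _
          map_add' := fun s t => by
            change secRes X _ (c.comp s b k + c.comp t b k) = _
            exact map_add _ _ _ }
      naturality := fun {V W} i => by
        ext s
        change secRes X _ (secRes X _ (c.comp s b k)) =
          secRes X i.unop.left.le (secRes X _ (c.comp s b k))
        rw [secRes_secRes, secRes_secRes] }
    (fun V (r : Γ(X, V.unop.left)) (s : Γ(c.glued, V.unop.left)) => by
      change secRes X (V' := V.unop.left) _ (c.comp (r • s) b k) =
        r * secRes X (V' := V.unop.left) _ (c.comp s b k)
      rw [comp_smul, map_mul, secRes_secRes, secRes_self])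

/-- Values of the coordinate morphism. [folklore] -/
@[simp]
lemma appLE_coordHom (b : ι) (k : c.I b) {W : X.Opens} (l : W ⟶ c.U b) (s : Γ(c.glued, W)) :
    appLE (c.coordHom b k) l s = secRes X (le_inf le_rfl l.le) (c.comp s b k) := rfl

/-- A composition into a sum of coprojections collapses when the components are `δ_{jk}`
(abstract form, any sheaf of rings). [folklore] -/
lemma comp_sum_comp_ιFree_eq {C : Type*} [Category C] {J : GrothendieckTopology C}
    {R : Sheaf J RingCat.{u}} [HasWeakSheafify J AddCommGrpCat.{u}]
    [J.WEqualsLocallyBijective AddCommGrpCat.{u}] {K : Type u} [Fintype K]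
    {M : SheafOfModules.{u} R} (u : K → (SheafOfModules.unit R ⟶ M))
    (φ : K → (M ⟶ SheafOfModules.unit R)) (hA : ∀ j, u j ≫ φ j = 𝟙 _)
    (hB : ∀ j k, j ≠ k → u j ≫ φ k = 0) (j : K) :
    u j ≫ ∑ k, φ k ≫ SheafOfModules.ιFree k = SheafOfModules.ιFree j := by
  rw [Preadditive.comp_sum, Finset.sum_eq_single j, ← Category.assoc, hA, Category.id_comp]
  · intro k _ hkj
    rw [← Category.assoc, hB j k (Ne.symm hkj), zero_comp]
  · intro h
    exact absurd (Finset.mem_univ j) h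

/-- Reassociating a sum of coprojections followed by a morphism (abstract form). [folklore] -/
lemma sum_comp_ιFree_comp {C : Type*} [Category C] {J : GrothendieckTopology C}
    {R : Sheaf J RingCat.{u}} [HasWeakSheafify J AddCommGrpCat.{u}]
    [J.WEqualsLocallyBijective AddCommGrpCat.{u}] {K : Type u} [Fintype K]
    {M N : SheafOfModules.{u} R} (φ : K → (M ⟶ SheafOfModules.unit R))
    (f : SheafOfModules.free K ⟶ N) :
    (∑ k, φ k ≫ SheafOfModules.ιFree k) ≫ f = ∑ k, φ k ≫ (SheafOfModules.ιFree k ≫ f) := by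
  rw [Preadditive.sum_comp]
  simp_rw [Category.assoc]

/-- The morphism `𝒪^{n_b} → (glued c)|_{U_b}` sending the `k`-th basis vector to the column section
`t_{b,k}`. [folklore] -/
def frameHom (b : ι) : SheafOfModules.free (c.I b) ⟶ c.glued.over (c.U b) :=
  (c.glued.over (c.U b)).freeHomEquiv.symm fun k =>
    (Scheme.Modules.overSectionsEquiv c.glued (c.U b)).symm (c.gen b k (c.U b) le_rfl)

/-- On the `k`-th copy of `𝒪`, `frameHom` is `r ↦ r t_{b,k}`. [folklore] -/
lemma ιFree_comp_frameHom (b : ι) (k : c.I b) :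
    SheafOfModules.ιFree k ≫ c.frameHom b = smulSection (c.gen b k (c.U b) le_rfl) := by
  rw [frameHom, ιFree_comp_freeHomEquiv_symm]
  exact hom_ext_of_appLE (E := unitModule X) (M := c.glued) (U := c.U b) fun W l r => by
    rw [appLE_smulSection]
    rfl

/-- The morphism `(glued c)|_{U_b} → 𝒪^{n_b}`, `s ↦ ((s_b)_k)_k`. [folklore] -/
def frameInv (b : ι) : c.glued.over (c.U b) ⟶ SheafOfModules.free (c.I b) :=
  ∑ k, c.coordHom b k ≫ SheafOfModules.ιFree k

/-- `(t_{b,j})_b = e_j`: the `k`-th coordinate of the `j`-th column section in its own chart is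
`δ_{jk}` (as the value at `1` of the composite `𝒪 → (glued c)|_{U_b} → 𝒪`). [folklore] -/
lemma ιFree_comp_frameHom_comp_coordHom_val (b : ι) (j k : c.I b)
    (V : (CategoryTheory.Over (c.U b))ᵒᵖ) :
    (if j = k then (1 : Γ(X, V.unop.left)) else 0) =
      ((SheafOfModules.ιFree j ≫ c.frameHom b) ≫ c.coordHom b k).val.app V
        (1 : (X.ringCatSheaf.over (c.U b)).obj.obj V) := by
  rw [ιFree_comp_frameHom]
  change _ = secRes X (le_inf le_rfl V.unop.hom.le)
    (c.comp ((1 : Γ(X, V.unop.left)) • c.glued.presheaf.map V.unop.hom.op (c.gen b j (c.U b) le_rfl))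
      b k)
  rw [one_smul, map_gen, comp_gen, c.map_g_apply, c.g_self_apply]
  by_cases hjk : j = k
  · subst hjk
    simp only [if_true]
  · simp only [if_neg hjk, if_neg (Ne.symm hjk)]

/-- `(t_{b,j})_b = e_j`, diagonal part: `𝒪 → (glued c)|_{U_b} → 𝒪` on the `j`-th copies is the
identity. [folklore] -/
lemma ιFree_comp_frameHom_comp_coordHom_self (b : ι) (j : c.I b) :
    (SheafOfModules.ιFree j ≫ c.frameHom b) ≫ c.coordHom b j = 𝟙 _ := by
  apply ((unitModule X).over (c.U b)).unitHomEquiv.injective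
  refine PresheafOfModules.sections_ext _ _ fun V => ?_
  rw [SheafOfModules.unitHomEquiv_apply_coe, SheafOfModules.unitHomEquiv_apply_coe,
    ← ιFree_comp_frameHom_comp_coordHom_val, if_pos rfl]
  rfl

/-- `(t_{b,j})_b = e_j`, off-diagonal part. [folklore] -/
lemma ιFree_comp_frameHom_comp_coordHom_of_ne (b : ι) {j k : c.I b} (h : j ≠ k) :
    (SheafOfModules.ιFree j ≫ c.frameHom b) ≫ c.coordHom b k = 0 := by
  apply ((unitModule X).over (c.U b)).unitHomEquiv.injective
  refine PresheafOfModules.sections_ext _ _ fun V => ?_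
  rw [SheafOfModules.unitHomEquiv_apply_coe, SheafOfModules.unitHomEquiv_apply_coe,
    ← ιFree_comp_frameHom_comp_coordHom_val, if_neg h]
  rfl

/-- `frameHom ≫ frameInv = 𝟙`. [folklore] -/
lemma frameHom_comp_frameInv (b : ι) : c.frameHom b ≫ c.frameInv b = 𝟙 _ := by
  refine Cofan.IsColimit.hom_ext (SheafOfModules.isColimitFreeCofan (c.I b)) _ _ fun j => ?_
  rw [SheafOfModules.freeCofan_inj]
  have h := comp_sum_comp_ιFree_eq (fun j => SheafOfModules.ιFree j ≫ c.frameHom b) (c.coordHom b)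
    (c.ιFree_comp_frameHom_comp_coordHom_self b)
    (fun j k hjk => c.ιFree_comp_frameHom_comp_coordHom_of_ne b hjk) j
  exact (Category.assoc _ _ _).symm.trans (h.trans (Category.comp_id _).symm)

/-- `frameInv ≫ frameHom = 𝟙` (every section is `∑_k (s_b)_k t_{b,k}`). [folklore] -/
lemma frameInv_comp_frameHom (b : ι) : c.frameInv b ≫ c.frameHom b = 𝟙 _ := by
  have h : c.frameInv b ≫ c.frameHom b =
      ∑ k, c.coordHom b k ≫ smulSection (c.gen b k (c.U b) le_rfl) :=
    (sum_comp_ιFree_comp _ _).trans (Finset.sum_congr rfl fun k _ => by rw [ιFree_comp_frameHom]; rfl)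
  rw [h]
  refine hom_ext_of_appLE (E := c.glued) (M := c.glued) (U := c.U b) fun W l s => ?_
  rw [appLE_sum, appLE_id]
  simp_rw [appLE_comp, appLE_smulSection, appLE_coordHom, map_gen]
  exact (c.eq_sum_smul_gen b W l.le s).symm

/-- **The local frame `𝒪^{n_b} ≅ (glued c)|_{U_b}`** on the column sections `t_{b,k}`.
[cite: Hartshorne1977, II Ex. 5.18] -/
def frame (b : ι) : SheafOfModules.free (c.I b) ≅ c.glued.over (c.U b) where
  hom := c.frameHom b
  inv := c.frameInv b
  hom_inv_id := c.frameHom_comp_frameInv b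
  inv_hom_id := c.frameInv_comp_frameHom b

/-- **The basis sections of the frame at `b` are the column sections `t_{b,k}`.** [folklore] -/
theorem basisSection_frame (b : ι) (k : c.I b) :
    basisSection (E := c.glued) (c.frame b) k = c.gen b k (c.U b) le_rfl := by
  rw [basisSection]
  change Scheme.Modules.overSectionsEquiv c.glued (c.U b)
    ((c.glued.over (c.U b)).freeHomEquiv (c.frameHom b) k) = _
  rw [frameHom, Equiv.apply_symm_apply, Equiv.apply_symm_apply]

/-- **The transition matrices of the frames of the glued module are the `g_{ab}`.**
[cite: Hartshorne1977, II Ex. 5.18] -/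
theorem transition_frame (a b : ι) {V : X.Opens} (k : V ⟶ c.U a) (k' : V ⟶ c.U b) :
    transition (c.frame a) (c.frame b) k k' = c.g a b V k.le k'.le := by
  ext i j
  rw [transition_apply, basisSection_frame, map_gen, c.gen_eq_sum_smul_gen a b j V k.le k'.le]
  have h : ∀ i, c.gen a i V k.le = c.glued.presheaf.map k.op (basisSection (E := c.glued) (c.frame a) i) :=
    fun i => by rw [basisSection_frame, map_gen]
  simp_rw [h]
  exact coord_sum_smul_basisSection (c.frame a) k _ i

/-- **The glued module is finite locally free** when the `U_a` cover `X`. [cite: StacksProject, Tag 01C6] -/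
theorem isFiniteLocallyFree_glued (hcov : ∀ x : X, ∃ a, x ∈ c.U a) : IsFiniteLocallyFree c.glued := by
  intro x
  obtain ⟨a, ha⟩ := hcov x
  exact ⟨c.U a, ha, c.I a, inferInstance, ⟨c.frame a⟩⟩

end MatrixCocycle

end Literature.AlgebraicGeometry.Modules

end
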